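import Mathlib
import HarnessLib
import Summits.CriticalPhenomena.PercolationContinuityZ3.Theses.PercLowPointHalfSpace
import Literature.Probability.Percolation.HalfSpaceFloorDilution
import Literature.Probability.Percolation.UniversalTightness
import Literature.Probability.Percolation.SiteConnectionTools
import Literature.Probability.Percolation.LatticeSymmetry
import Literature.Probability.Percolation.BondPercolationSymmetry
import Literature.Probability.LatticeModels.ProdBernoulliIndependence

/-!
# Canonical forms of the two hypothesis-stubs of line SketchIdeator1 (crux `LowPointBookkeeping`)

Helper file of line SketchIdeator1 (skeleton floor-russo) for the crux `LowPointBookkeeping`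
(stmt-CriticalPhenomena-14713, route PercLowPointHalfSpace).  The line closes the crux from two
hypothesis-stubs: A♯ₛ (`stub_twoArmSharpFloor`, quantified over the FOUR floor neighbours `e` of the
origin) and B♯ (`stub_noFatHalfBox`, quantified over FIVE half-boxes).  Both quantifiers are
cosmetic; this file reduces them to single instances, so that the hypotheses the planner has to
promote are canonical:

* `twoArmSharpFloor_of_e1` — **A♯ₛ for `e = (0,1,0)` alone implies A♯ₛ for all four neighbours**:
  the floor-diluted half-space measure `P^{ℍ}_{p_c,s}` is invariant under the signed coordinate
  permutations of `ℤ³` fixing the height coordinate (`map_signedPerm`: they preserve lattice edges,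
  floor edges and half-space edges, hence the weights; `prodBernoulli_map_image_equiv`), and these
  carry the two-arm event at `e` to the two-arm event at `σ e` (`preimage_twoArm`); the reflection
  `x₁ ↦ -x₁` and the transposition `x₁ ↔ x₂` (with or without the reflection `x₂ ↦ -x₂`) map
  `(0,1,0)` to the other three neighbours.  The single-neighbour form is the route's crux A
  (`BoundaryTwoArmDecay`) with exponent `11/4 + κ` and `P_{p_c}` replaced by `P^{ℍ}_{p_c,s}`, `∀ s`;
* `noFatHalfBox_of_origin` — **B♯ for the origin half-box `B_n ∩ ℍ` alone implies B♯ for the five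
  half-boxes** (constant `C ↦ 2^{11/4} C`): `(x + B_n) ∩ ℍ ⊆ B_{n+1} ∩ ℍ` for a floor neighbour `x`,
  `|K_max|` is monotone in the region (`clusterMaxIn_mono_set`), and `(n+1)^{11/4} ≤ (2n)^{11/4}`.

Registered wrappers: `stub_reduceTwoArm`, `stub_reduceNoFat` (def-free signatures on the crux item).
-/

noncomputable section

open MeasureTheory Filter Topology
open Literature.Probability.Percolation Literature.Probability.LatticeModels
open scoped ENNReal

namespace Summit.CriticalPhenomena.PercolationContinuityZ3.Theorems.FloorRusso.Reduce

/-- The floor-diluted critical half-space measure at floor density `s` (local notation). -/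
local notation3 (prettyPrint := false) "μH" =>
  (fun s : unitInterval => (floorDilutedPercolation 3 (criticalProbI 3) s : Measure (BondConfig (Site 3))))

/-- The closed half-space `ℍ = {x₀ ≥ 0}` (local notation). -/
local notation3 (prettyPrint := false) "HS" => ({x : Site 3 | 0 ≤ x 0} : Set (Site 3))

/-- The four floor neighbours of the origin (local notation). -/
local notation3 (prettyPrint := false) "nbrs" =>
  ({Pi.single 1 1, Pi.single 1 (-1), Pi.single 2 1, Pi.single 2 (-1)} : Finset (Site 3))

/-- The sharp two-arm event at the floor neighbour `e` and scale `r`: `arm_ℍ(0,r)`, `arm_ℍ(e,r)` and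
`0 ↮_ℍ e` (verbatim the registered stub's event; local notation). -/
local notation3 (prettyPrint := false) "𝑱⟦" e "," r "⟧" =>
  (({ω | ∃ y : Site 3, (∃ i : Fin 3, ((r : ℕ) : ℤ) ≤ |y i|) ∧ ω ∈ openConnIn {x : Site 3 | 0 ≤ x 0} 0 y} ∩
      {ω | ∃ y : Site 3, (∃ i : Fin 3, ((r : ℕ) : ℤ) ≤ |y i - e i|) ∧ ω ∈ openConnIn {x : Site 3 | 0 ≤ x 0} e y} ∩
      (openConnIn {x : Site 3 | 0 ≤ x 0} 0 e)ᶜ : Set (BondConfig (Site 3))))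

/-! ### (a) One half-box suffices for B♯ -/

/-- `|K_v ∩ Λ|` is monotone in the region `Λ`. -/
theorem clusterCapIn_mono_set {V : Type*} {Λ Λ' : Finset V} (h : Λ ⊆ Λ') (ω : BondConfig V) (v : V) :
    clusterCapIn Λ ω v ≤ clusterCapIn Λ' ω v := by
  classical
  rw [clusterCapIn_eq, clusterCapIn_eq]
  exact Finset.card_le_card (Finset.filter_subset_filter _ h)

/-- `|K_max(Λ)|` is monotone in the region `Λ`. -/
theorem clusterMaxIn_mono_set {V : Type*} {Λ Λ' : Finset V} (h : Λ ⊆ Λ') (ω : BondConfig V) :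
    clusterMaxIn Λ ω ≤ clusterMaxIn Λ' ω := by
  show (Λ.sup fun v => clusterCapIn Λ ω v) ≤ clusterMaxIn Λ' ω
  exact Finset.sup_le fun v hv =>
    (clusterCapIn_mono_set h ω v).trans (clusterCapIn_le_clusterMaxIn (h hv) ω)

/-- The coordinates of a floor neighbour of the origin lie in `[-1, 1]`. -/
theorem nbrs_coord_bound {x : Site 3} (hx : x ∈ nbrs) (i : Fin 3) : -1 ≤ x i ∧ x i ≤ 1 := by
  simp only [Finset.mem_insert, Finset.mem_singleton] at hx
  rcases hx with rfl | rfl | rfl | rfl <;> fin_cases i <;> simp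

/-- The half-box at a floor neighbour `x` lies inside the origin half-box of the next size:
`(x + B_n) ∩ ℍ ⊆ B_{n+1} ∩ ℍ`. -/
theorem halfBox_subset {x : Site 3} (hx : x ∈ nbrs) (n : ℕ) :
    (((box 3 n).image fun y : Site 3 => x + y).filter fun z : Site 3 => 0 ≤ z 0) ⊆
      (box 3 (n + 1)).filter fun z : Site 3 => 0 ≤ z 0 := by
  intro z hz
  simp only [Finset.mem_filter, Finset.mem_image] at hz ⊢
  obtain ⟨⟨y, hy, rfl⟩, hz0⟩ := hz
  refine ⟨?_, hz0⟩
  rw [mem_box] at hy ⊢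
  intro i
  have h1 := hy i
  have h2 := nbrs_coord_bound hx i
  simp only [Pi.add_apply]
  push_cast
  omega

/-- **One half-box suffices for B♯.**  The no-fat-half-box hypothesis for the origin half-box
`B_n ∩ ℍ` (constant `C`) implies the registered five-box form `stub_noFatHalfBox` (constant
`2^{11/4} C`). -/
theorem noFatHalfBox_of_origin
    (h : ∃ C : ℝ, 0 < C ∧ ∀ n : ℕ, 1 ≤ n →
      (μH 1).real {ω | C * (n : ℝ) ^ ((11 : ℝ) / 4) ≤
        (clusterMaxIn ((box 3 n).filter fun z : Site 3 => 0 ≤ z 0) ω : ℝ)} ≤ Real.exp (-1)) :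
    ∃ C : ℝ, 0 < C ∧ ∀ x ∈ insert (0 : Site 3) nbrs, ∀ n : ℕ, 1 ≤ n →
      (μH 1).real {ω | C * (n : ℝ) ^ ((11 : ℝ) / 4) ≤
        (clusterMaxIn (((box 3 n).image fun y : Site 3 => x + y).filter fun z : Site 3 => 0 ≤ z 0) ω : ℝ)}
          ≤ Real.exp (-1) := by
  obtain ⟨C, hC, h⟩ := h
  have h2 : (1 : ℝ) ≤ (2 : ℝ) ^ ((11 : ℝ) / 4) := Real.one_le_rpow (by norm_num) (by norm_num)
  refine ⟨C * (2 : ℝ) ^ ((11 : ℝ) / 4), by positivity, fun x hx n hn => ?_⟩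
  have hn1 : (1 : ℝ) ≤ n := by exact_mod_cast hn
  have hnp : 0 ≤ (n : ℝ) ^ ((11 : ℝ) / 4) := by positivity
  rw [Finset.mem_insert] at hx
  rcases hx with rfl | hx
  · have himg : ((box 3 n).image fun y : Site 3 => (0 : Site 3) + y) = box 3 n := by
      simp only [zero_add, Finset.image_id']
    rw [himg]
    refine le_trans (measureReal_mono (fun ω hω => ?_) (measure_ne_top _ _)) (h n hn)
    simp only [Set.mem_setOf_eq] at hω ⊢
    refine le_trans ?_ hω
    nlinarith [mul_nonneg hC.le hnp]
  · have hsub := halfBox_subset hx n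
    refine le_trans (measureReal_mono (fun ω hω => ?_) (measure_ne_top _ _)) (h (n + 1) (by omega))
    simp only [Set.mem_setOf_eq] at hω ⊢
    have hK : (clusterMaxIn (((box 3 n).image fun y : Site 3 => x + y).filter
          fun z : Site 3 => 0 ≤ z 0) ω : ℝ) ≤
        (clusterMaxIn ((box 3 (n + 1)).filter fun z : Site 3 => 0 ≤ z 0) ω : ℝ) := by
      exact_mod_cast clusterMaxIn_mono_set hsub ω
    refine le_trans ?_ (hω.trans hK)
    have hle : (((n + 1 : ℕ) : ℝ)) ≤ 2 * (n : ℝ) := by push_cast; linarith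
    have hpow : (((n + 1 : ℕ) : ℝ)) ^ ((11 : ℝ) / 4) ≤ (2 * (n : ℝ)) ^ ((11 : ℝ) / 4) :=
      Real.rpow_le_rpow (by positivity) hle (by norm_num)
    rw [Real.mul_rpow (by norm_num) (by positivity)] at hpow
    calc C * (((n + 1 : ℕ) : ℝ)) ^ ((11 : ℝ) / 4) ≤ C * ((2 : ℝ) ^ ((11 : ℝ) / 4) * (n : ℝ) ^ ((11 : ℝ) / 4)) :=
          mul_le_mul_of_nonneg_left hpow hC.le
      _ = C * (2 : ℝ) ^ ((11 : ℝ) / 4) * (n : ℝ) ^ ((11 : ℝ) / 4) := by ring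

/-! ### (b) One neighbour suffices for A♯ₛ: signed coordinate permutations fixing the height -/

section Symmetry

variable (π : Equiv.Perm (Fin 3)) (ε : Fin 3 → ℤˣ)

/-- A signed permutation fixing the height coordinate (`π⁻¹ 0 = 0`, `ε 0 = 1`) preserves `x₀`. -/
theorem signedPerm_apply_zero (hπ : π.symm 0 = 0) (hε : ε 0 = 1) (x : Site 3) :
    Site.signedPerm π ε x 0 = x 0 := by
  simp [Site.signedPerm_apply, hπ, hε]

/-- Absolute values of coordinates are permuted. -/
theorem abs_signedPerm_apply (x : Site 3) (i : Fin 3) :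
    |Site.signedPerm π ε x i| = |x (π.symm i)| := by
  rw [Site.signedPerm_apply, abs_mul]
  rcases Int.units_eq_one_or (ε i) with h | h <;> simp [h]

/-- The sup-distance condition `∃ i, r ≤ |x i|` is invariant. -/
theorem far_signedPerm_iff (r : ℤ) (x : Site 3) :
    (∃ i : Fin 3, r ≤ |Site.signedPerm π ε x i|) ↔ ∃ i : Fin 3, r ≤ |x i| := by
  constructor
  · rintro ⟨i, hi⟩
    exact ⟨π.symm i, by rwa [abs_signedPerm_apply] at hi⟩
  · rintro ⟨j, hj⟩
    refine ⟨π j, ?_⟩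
    rw [abs_signedPerm_apply, Equiv.symm_apply_apply]
    exact hj

/-- Signed permutations are subtractive. -/
theorem signedPerm_sub (x y : Site 3) :
    Site.signedPerm π ε (x - y) = Site.signedPerm π ε x - Site.signedPerm π ε y := by
  funext i; simp [mul_sub]

/-- The shifted sup-distance condition `∃ i, r ≤ |x i - e i|` is invariant. -/
theorem far_sub_signedPerm_iff (r : ℤ) (x e : Site 3) :
    (∃ i : Fin 3, r ≤ |Site.signedPerm π ε x i - Site.signedPerm π ε e i|) ↔
      ∃ i : Fin 3, r ≤ |x i - e i| := by
  have h : ∀ i, Site.signedPerm π ε x i - Site.signedPerm π ε e i = Site.signedPerm π ε (x - e) i := by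
    intro i; rw [signedPerm_sub, Pi.sub_apply]
  simp_rw [h, far_signedPerm_iff, Pi.sub_apply]

/-- A signed permutation maps lattice edges to lattice edges. -/
theorem signedPerm_mem_edgeSet_iff (e : Sym2 (Site 3)) :
    sym2Equiv (Site.signedPerm π ε) e ∈ (zdGraph 3).edgeSet ↔ e ∈ (zdGraph 3).edgeSet :=
  sym2Equiv_mem_edgeSet_iff (zdSignedPermIso π ε) e

/-- A height-fixing signed permutation maps floor edges to floor edges. -/
theorem signedPerm_mem_floorEdgeSet_iff (hπ : π.symm 0 = 0) (hε : ε 0 = 1) (e : Sym2 (Site 3)) :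
    sym2Equiv (Site.signedPerm π ε) e ∈ floorEdgeSet 3 ↔ e ∈ floorEdgeSet 3 := by
  rw [mem_floorEdgeSet_iff, mem_floorEdgeSet_iff, signedPerm_mem_edgeSet_iff]
  refine and_congr_right fun _ => ?_
  simp only [sym2Equiv_apply, Sym2.mem_map]
  constructor
  · intro h w hw
    have := h (Site.signedPerm π ε w) ⟨w, hw, rfl⟩
    rwa [signedPerm_apply_zero π ε hπ hε] at this
  · rintro h _ ⟨w, hw, rfl⟩
    rw [signedPerm_apply_zero π ε hπ hε]
    exact h w hw

/-- A height-fixing signed permutation maps half-space edges to half-space edges. -/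
theorem signedPerm_mem_halfSpaceEdgeSet_iff (hπ : π.symm 0 = 0) (hε : ε 0 = 1) (e : Sym2 (Site 3)) :
    sym2Equiv (Site.signedPerm π ε) e ∈ halfSpaceEdgeSet 3 ↔ e ∈ halfSpaceEdgeSet 3 := by
  rw [mem_halfSpaceEdgeSet_iff, mem_halfSpaceEdgeSet_iff, signedPerm_mem_edgeSet_iff]
  refine and_congr_right fun _ => ?_
  simp only [sym2Equiv_apply, Sym2.mem_map]
  constructor
  · intro h w hw
    have := h (Site.signedPerm π ε w) ⟨w, hw, rfl⟩
    rwa [signedPerm_apply_zero π ε hπ hε] at this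
  · rintro h _ ⟨w, hw, rfl⟩
    rw [signedPerm_apply_zero π ε hπ hε]
    exact h w hw

/-- The floor-diluted weights are invariant under height-fixing signed permutations. -/
theorem floorDilutedParam_signedPerm (p s : unitInterval) (hπ : π.symm 0 = 0) (hε : ε 0 = 1)
    (e : Sym2 (Site 3)) :
    floorDilutedParam 3 p s (sym2Equiv (Site.signedPerm π ε) e) = floorDilutedParam 3 p s e := by
  by_cases hf : e ∈ floorEdgeSet 3
  · rw [floorDilutedParam_of_mem_floorEdgeSet p s hf,
      floorDilutedParam_of_mem_floorEdgeSet p s ((signedPerm_mem_floorEdgeSet_iff π ε hπ hε e).2 hf)]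
  · have hf' : sym2Equiv (Site.signedPerm π ε) e ∉ floorEdgeSet 3 :=
      fun h => hf ((signedPerm_mem_floorEdgeSet_iff π ε hπ hε e).1 h)
    by_cases hh : e ∈ halfSpaceEdgeSet 3
    · rw [floorDilutedParam_of_not_mem_floorEdgeSet p s hh hf,
        floorDilutedParam_of_not_mem_floorEdgeSet p s
          ((signedPerm_mem_halfSpaceEdgeSet_iff π ε hπ hε e).2 hh) hf']
    · rw [floorDilutedParam_of_not_mem_halfSpaceEdgeSet p s hh,
        floorDilutedParam_of_not_mem_halfSpaceEdgeSet p s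
          fun h => hh ((signedPerm_mem_halfSpaceEdgeSet_iff π ε hπ hε e).1 h)]

/-- **Invariance of `P^{ℍ}_{p_c,s}` under height-fixing signed permutations.** -/
theorem map_signedPerm (s : unitInterval) (hπ : π.symm 0 = 0) (hε : ε 0 = 1) :
    (μH s).map (BondConfig.relabel (sym2Equiv (Site.signedPerm π ε))) = μH s :=
  prodBernoulli_map_image_equiv (floorDilutedParam 3 (criticalProbI 3) s)
    (sym2Equiv (Site.signedPerm π ε)) (floorDilutedParam_signedPerm π ε _ s hπ hε)

/-- A height-fixing signed permutation maps `ℍ` onto `ℍ`. -/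
theorem image_signedPerm_halfSpace (hπ : π.symm 0 = 0) (hε : ε 0 = 1) :
    Site.signedPerm π ε '' HS = HS := by
  ext z
  simp only [Set.mem_image, Set.mem_setOf_eq]
  constructor
  · rintro ⟨w, hw, rfl⟩
    rwa [signedPerm_apply_zero π ε hπ hε]
  · intro hz
    refine ⟨(Site.signedPerm π ε).symm z, ?_, Equiv.apply_symm_apply _ _⟩
    have := signedPerm_apply_zero π ε hπ hε ((Site.signedPerm π ε).symm z)
    rw [Equiv.apply_symm_apply] at this
    rw [this] at hz
    exact hz

/-- Transport of `ℍ`-restricted connections: `σ '' ω ∈ {σ x ↔_ℍ σ y} ↔ ω ∈ {x ↔_ℍ y}`. -/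
theorem relabel_mem_openConnIn_halfSpace_iff (hπ : π.symm 0 = 0) (hε : ε 0 = 1)
    (ω : BondConfig (Site 3)) (x y : Site 3) :
    BondConfig.relabel (sym2Equiv (Site.signedPerm π ε)) ω ∈
        openConnIn HS (Site.signedPerm π ε x) (Site.signedPerm π ε y) ↔
      ω ∈ openConnIn HS x y := by
  constructor
  · intro h
    have h' := relabel_mem_openConnIn (Site.signedPerm π ε).symm h
    rw [relabel_symm_relabel, Equiv.symm_apply_apply, Equiv.symm_apply_apply,
      ← image_signedPerm_halfSpace π ε hπ hε, Equiv.symm_image_image] at h'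
    exact h'
  · intro h
    have h' := relabel_mem_openConnIn (Site.signedPerm π ε) h
    rwa [image_signedPerm_halfSpace π ε hπ hε] at h'

/-- **The two-arm event is transported**: the pull-back of the event at `σ e` is the event at `e`. -/
theorem preimage_twoArm (hπ : π.symm 0 = 0) (hε : ε 0 = 1) (e : Site 3) (r : ℕ) :
    (BondConfig.relabel (sym2Equiv (Site.signedPerm π ε))) ⁻¹' 𝑱⟦Site.signedPerm π ε e, r⟧ =
      𝑱⟦e, r⟧ := by
  ext ω
  simp only [Set.mem_preimage, Set.mem_inter_iff, Set.mem_compl_iff, Set.mem_setOf_eq]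
  have h0 : Site.signedPerm π ε 0 = 0 := Site.signedPerm_zero π ε
  refine and_congr (and_congr ?_ ?_) (not_congr ?_)
  · constructor
    · rintro ⟨y, hy, hc⟩
      refine ⟨(Site.signedPerm π ε).symm y, ?_, ?_⟩
      · rwa [← far_signedPerm_iff π ε, Equiv.apply_symm_apply]
      · rw [← relabel_mem_openConnIn_halfSpace_iff π ε hπ hε, h0, Equiv.apply_symm_apply]
        exact hc
    · rintro ⟨y, hy, hc⟩
      refine ⟨Site.signedPerm π ε y, (far_signedPerm_iff π ε _ y).2 hy, ?_⟩
      have := (relabel_mem_openConnIn_halfSpace_iff π ε hπ hε ω 0 y).2 hc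
      rwa [h0] at this
  · constructor
    · rintro ⟨y, hy, hc⟩
      refine ⟨(Site.signedPerm π ε).symm y, ?_, ?_⟩
      · have hy' : ∃ i : Fin 3, ((r : ℕ) : ℤ) ≤
            |Site.signedPerm π ε ((Site.signedPerm π ε).symm y) i - Site.signedPerm π ε e i| := by
          simpa only [Equiv.apply_symm_apply] using hy
        exact (far_sub_signedPerm_iff π ε _ _ e).1 hy'
      · rw [← relabel_mem_openConnIn_halfSpace_iff π ε hπ hε, Equiv.apply_symm_apply]
        exact hc
    · rintro ⟨y, hy, hc⟩
      exact ⟨Site.signedPerm π ε y, (far_sub_signedPerm_iff π ε _ y e).2 hy,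
        (relabel_mem_openConnIn_halfSpace_iff π ε hπ hε ω e y).2 hc⟩
  · have := relabel_mem_openConnIn_halfSpace_iff π ε hπ hε ω 0 e
    rwa [h0] at this

/-- **Equal probabilities**: `P^{ℍ}_{p_c,s}(J(σ e, r)) = P^{ℍ}_{p_c,s}(J(e, r))`. -/
theorem real_twoArm_signedPerm (hπ : π.symm 0 = 0) (hε : ε 0 = 1) (s : unitInterval)
    (e : Site 3) (r : ℕ) :
    (μH s).real 𝑱⟦Site.signedPerm π ε e, r⟧ = (μH s).real 𝑱⟦e, r⟧ := by
  conv_lhs => rw [← map_signedPerm π ε s hπ hε]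
  simp only [measureReal_def]
  rw [MeasurableEquiv.map_apply, preimage_twoArm π ε hπ hε]

end Symmetry

/-- Every floor neighbour of the origin is the image of `(0,1,0)` under a height-fixing signed
coordinate permutation. -/
theorem exists_signedPerm_of_mem_nbrs {e : Site 3} (he : e ∈ nbrs) :
    ∃ (π : Equiv.Perm (Fin 3)) (ε : Fin 3 → ℤˣ), π.symm 0 = 0 ∧ ε 0 = 1 ∧
      e = Site.signedPerm π ε (Pi.single 1 1) := by
  simp only [Finset.mem_insert, Finset.mem_singleton] at he
  have h1 : (1 : Equiv.Perm (Fin 3)).symm = 1 := rfl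
  rcases he with rfl | rfl | rfl | rfl
  · refine ⟨1, 1, rfl, rfl, ?_⟩
    funext i; fin_cases i <;> simp [Site.signedPerm_apply, h1]
  · refine ⟨1, Function.update 1 1 (-1), rfl, by simp, ?_⟩
    funext i; fin_cases i <;> simp [Site.signedPerm_apply, h1]
  · refine ⟨Equiv.swap 1 2, 1, by decide, rfl, ?_⟩
    funext i; fin_cases i <;> simp [Site.signedPerm_apply, Equiv.swap_apply_def]
  · refine ⟨Equiv.swap 1 2, Function.update 1 2 (-1), by decide, by simp, ?_⟩
    funext i; fin_cases i <;> simp [Site.signedPerm_apply, Equiv.swap_apply_def]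

/-- **One neighbour suffices for A♯ₛ.**  The sharp floor-uniform two-arm bound for the single
neighbour `e = (0,1,0)` implies the registered four-neighbour form `stub_twoArmSharpFloor`
(same `κ`, same `C`). -/
theorem twoArmSharpFloor_of_e1
    (h : ∃ κ C : ℝ, 0 < κ ∧ ∀ s : unitInterval, ∀ r : ℕ, 1 ≤ r →
      (μH s).real 𝑱⟦(Pi.single 1 1 : Site 3), r⟧ ≤ C * (r : ℝ) ^ (-(11 / 4 + κ))) :
    ∃ κ C : ℝ, 0 < κ ∧ ∀ s : unitInterval, ∀ e ∈ nbrs, ∀ r : ℕ, 1 ≤ r →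
      (μH s).real 𝑱⟦e, r⟧ ≤ C * (r : ℝ) ^ (-(11 / 4 + κ)) := by
  obtain ⟨κ, C, hκ, h⟩ := h
  refine ⟨κ, C, hκ, fun s e he r hr => ?_⟩
  obtain ⟨π, ε, hπ, hε, rfl⟩ := exists_signedPerm_of_mem_nbrs he
  rw [real_twoArm_signedPerm π ε hπ hε]
  exact h s r hr

/-! ### Registered wrappers (def-free signatures, registered on the crux item) -/

/-- **Registered wrapper `stub_reduceTwoArm`**: A♯ₛ at the single neighbour `(0,1,0)` → the registered
four-neighbour `stub_twoArmSharpFloor`; verbatim `twoArmSharpFloor_of_e1`. -/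
theorem stub_reduceTwoArm : (∃ κ C : ℝ, 0 < κ ∧ ∀ s : unitInterval, ∀ r : ℕ, 1 ≤ r → (floorDilutedPercolation 3 (criticalProbI 3) s).real ({ω | ∃ y : Site 3, (∃ i : Fin 3, ((r : ℕ) : ℤ) ≤ |y i|) ∧ ω ∈ openConnIn {x : Site 3 | 0 ≤ x 0} 0 y} ∩ {ω | ∃ y : Site 3, (∃ i : Fin 3, ((r : ℕ) : ℤ) ≤ |y i - (Pi.single 1 1 : Site 3) i|) ∧ ω ∈ openConnIn {x : Site 3 | 0 ≤ x 0} (Pi.single 1 1) y} ∩ (openConnIn {x : Site 3 | 0 ≤ x 0} 0 (Pi.single 1 1))ᶜ) ≤ C * (r : ℝ) ^ (-(11 / 4 + κ))) → (∃ κ C : ℝ, 0 < κ ∧ ∀ s : unitInterval, ∀ e ∈ ({Pi.single 1 1, Pi.single 1 (-1), Pi.single 2 1, Pi.single 2 (-1)} : Finset (Site 3)), ∀ r : ℕ, 1 ≤ r → (floorDilutedPercolation 3 (criticalProbI 3) s).real ({ω | ∃ y : Site 3, (∃ i : Fin 3, ((r : ℕ) : ℤ) ≤ |y i|) ∧ ω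 ∈ openConnIn {x : Site 3 | 0 ≤ x 0} 0 y} ∩ {ω | ∃ y : Site 3, (∃ i : Fin 3, ((r : ℕ) : ℤ) ≤ |y i - e i|) ∧ ω ∈ openConnIn {x : Site 3 | 0 ≤ x 0} e y} ∩ (openConnIn {x : Site 3 | 0 ≤ x 0} 0 e)ᶜ) ≤ C * (r : ℝ) ^ (-(11 / 4 + κ))) :=
  twoArmSharpFloor_of_e1

/-- **Registered wrapper `stub_reduceNoFat`**: B♯ for the origin half-box → the registered five-box
`stub_noFatHalfBox`; verbatim `noFatHalfBox_of_origin`. -/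
theorem stub_reduceNoFat : (∃ C : ℝ, 0 < C ∧ ∀ n : ℕ, 1 ≤ n → (floorDilutedPercolation 3 (criticalProbI 3) 1).real {ω | C * (n : ℝ) ^ ((11 : ℝ) / 4) ≤ (clusterMaxIn ((box 3 n).filter fun z : Site 3 => 0 ≤ z 0) ω : ℝ)} ≤ Real.exp (-1)) → (∃ C : ℝ, 0 < C ∧ ∀ x ∈ insert (0 : Site 3) ({Pi.single 1 1, Pi.single 1 (-1), Pi.single 2 1, Pi.single 2 (-1)} : Finset (Site 3)), ∀ n : ℕ, 1 ≤ n → (floorDilutedPercolation 3 (criticalProbI 3) 1).real {ω | C * (n : ℝ) ^ ((11 : ℝ) / 4) ≤ (clusterMaxIn (((box 3 n).image fun y : Site 3 => x + y).filter fun z : Site 3 => 0 ≤ z 0) ω : ℝ)} ≤ Real.exp (-1)) :=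
  noFatHalfBox_of_origin

end Summit.CriticalPhenomena.PercolationContinuityZ3.Theorems.FloorRusso.Reduce

end
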